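import Summits.QuantumFields.GaugeBoot.DiagonalRPTorusTubeLayers
import HarnessLib

/-!
# The back plaquettes through a transverse square on the top inner layer (gauge-boot, L3 sequel, 6/9)

HONEST FRAMING (cell `pub-gaugeboot`, page 1 of every file): the venture produces certified bounds
on lattice expectations at stated coupling, gauge group, dimension and torus size; NOT a mass gap,
NOT a continuum limit, NOT a string tension; NOT Yang–Mills-summit-bearing (barriers
`FixedCouplingUltralocality`, `PerturbativeInvisibility`). This module is bookkeeping for a
structural NEGATIVE result (`DiagonalRPTorusInnerHalfNegativeHighDim`); it discharges nothing by
itself.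

## Content (torus `(ℤ/L)^d`, `L = 2c`, `c ≥ 2`, mirror `y_i = y_j`, `i < j < k < l`, `h = c`)

* `mem_restPlaqs_of_back` — a plaquette with a vertex on the back layer `δ = c = -c` is a rest
  plaquette (neither inner nor the mirror image of an inner one);
* **`cover_low`** — for a transverse square `sq k l x` on the top inner layer `δ(x) = c - 1`, the
  rest plaquettes containing its edge `a` are exactly the ring faces `ring i x a` (up through
  `+e_i`) and `ring j (x - e_j) a` (up through `-e_j`): every other plaquette through that edge is
  inner;
* **`cover_high`** — for `sq k l z` on the layer `δ(z) = -(c-1)` (the mirror image of the top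
  inner layer) they are `ring i (z - e_i) a` and `ring j z a`: every other one is the mirror
  image of an inner plaquette;
* the four ring families do lie in the rest (`ring_low_i_mem`, `ring_low_j_mem`,
  `ring_high_i_mem`, `ring_high_j_mem`).

Elementary bookkeeping; no named fact.
-/

open Finset Function

namespace Summit.QuantumFields.GaugeBoot

open Literature.MathematicalPhysics.QuantumFieldTheory

namespace DiagRPTube

variable {d L : ℕ}

/-! ## The cover lemmas -/

section Cover

variable {i j k l : Fin d} (hij : i < j) (hjk : j < k) (hkl : k < l) {c : ℕ} (hc : 2 ≤ c)
  (hL : L = 2 * c) [NeZero L]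

include hij hjk hkl hc hL

omit hij hjk hkl in
/-- A vertex on the back layer `c` puts `q` in the rest (`h = c`, `L = 2c`). -/
theorem mem_restPlaqs_of_back {q : Plaquette d L} (a : Fin 4)
    (ha : lay i j (vert q a) = ((c : ℕ) : ZMod L)) : q ∈ restPlaqs i j c :=
  mem_restPlaqs_of_vert a (by rw [ha]; exact not_val_c_lt hc hL)
    (by rw [ha, neg_cast_c hL]; exact not_val_c_lt hc hL)

/-- **The rest plaquettes through an edge of a transverse square on the top inner layer**
(`δ(x) = c - 1`): only the two ring faces `ring i x a` and `ring j (x - e_j) a`. -/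
theorem cover_low {x : Site d L} (hx : lay i j x = ((c - 1 : ℕ) : ZMod L)) {a : Fin 4}
    {q : Plaquette d L} (hq : q ∈ restPlaqs i j c) (hqa : HasLink q (link (sq k l hkl x) a)) :
    q = ring (hij.trans hjk) (hij.trans (hjk.trans hkl)) x a ∨
      q = ring hjk (hjk.trans hkl) (dn x j) a := by
  have hij' : i ≠ j := ne_of_lt hij
  have hki : k ≠ i := (ne_of_lt (hij.trans hjk)).symm
  have hkj : k ≠ j := (ne_of_lt hjk).symm
  have hli : l ≠ i := (ne_of_lt (hij.trans (hjk.trans hkl))).symm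
  have hlj : l ≠ j := (ne_of_lt (hjk.trans hkl)).symm
  have hs : lay i j (eStart k l x a) = ((c - 1 : ℕ) : ZMod L) := by
    rw [lay_eStart hki hkj hli hlj, hx]
  have hmi : eDir k l a ≠ i := by rcases eDir_eq_or (k := k) (l := l) a with h | h <;> rw [h] <;> assumption
  have hmj : eDir k l a ≠ j := by rcases eDir_eq_or (k := k) (l := l) a with h | h <;> rw [h] <;> assumption
  have hjm : j < eDir k l a := by rcases eDir_eq_or (k := k) (l := l) a with h | h <;> rw [h]; exact hjk; exact hjk.trans hkl
  have hv1 : ((c - 1 : ℕ) : ZMod L).val < c := val_cast_lt hL (by omega)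
  have hv2 : ((c - 2 : ℕ) : ZMod L).val < c := val_cast_lt hL (by omega)
  have hne : ((c - 1 : ℕ) : ZMod L) ≠ 0 := cast_pred_ne_zero hc hL
  have hsub : ((c - 1 : ℕ) : ZMod L) - 1 = ((c - 2 : ℕ) : ZMod L) := by
    rw [← cast_pred_pred_add_one (L := L) hc]; ring
  set s := eStart k l x a with hsdef
  set m := eDir k l a with hmdef
  rw [link_sq] at hqa
  obtain ⟨y, ⟨⟨a', b'⟩, hab⟩⟩ := q
  rcases (hasLink_iff' _ s m).1 hqa with ⟨hma, hy⟩ | ⟨hmb, hy⟩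
  · -- `m` is the first direction: the second direction `b' > m` is transverse
    simp only at hma hy
    subst hma
    have hbi : b' ≠ i := fun h => by rw [h] at hab; exact lt_asymm hab ((hij.trans hjm))
    have hbj : b' ≠ j := fun h => by rw [h] at hab; exact lt_asymm hab hjm
    exfalso
    refine not_mem_restPlaqs_of_layers (fun e => ?_) ?_ hq
    · have hy' : lay i j y = ((c - 1 : ℕ) : ZMod L) := by
        rcases hy with rfl | rfl
        · exact hs
        · rw [lay_dn_of_ne _ hbi hbj, hs]
      fin_cases e <;> simp only [vert] <;>
        [rw [hy']; rw [lay_shift_of_ne _ hmi hmj, hy'];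
          rw [lay_shift_of_ne _ hbi hbj, hy'];
          rw [lay_shift_of_ne _ hbi hbj, lay_shift_of_ne _ hmi hmj, hy']] <;> exact hv1
    · refine ⟨0, ?_⟩
      show lay i j y ≠ 0
      rcases hy with rfl | rfl
      · rw [hs]; exact hne
      · rw [lay_dn_of_ne _ hbi hbj, hs]; exact hne
  · -- `m` is the second direction; the first direction `a' < m` is `i`, `j` or transverse
    simp only at hmb hy
    subst hmb
    by_cases hai : a' = i
    · subst a'
      rcases hy with rfl | rfl
      · exact Or.inl rfl
      · exfalso
        refine not_mem_restPlaqs_of_layers (fun e => ?_) ?_ hq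
        · fin_cases e <;> simp only [vert]
          · rw [lay_dn_i hij', hs, hsub]; exact hv2
          · rw [dn_shift, hs]; exact hv1
          · rw [lay_shift_of_ne _ hmi hmj, lay_dn_i hij', hs, hsub]; exact hv2
          · rw [dn_shift, lay_shift_of_ne _ hmi hmj, hs]; exact hv1
        · refine ⟨1, ?_⟩
          show lay i j ((dn s i).shift i) ≠ 0
          rw [dn_shift, hs]; exact hne
    · by_cases haj : a' = j
      · subst a'
        rcases hy with rfl | rfl
        · exfalso
          refine not_mem_restPlaqs_of_layers (fun e => ?_) ?_ hq
          · fin_cases e <;> simp only [vert]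
            · rw [hs]; exact hv1
            · rw [lay_shift_j hij', hs, hsub]; exact hv2
            · rw [lay_shift_of_ne _ hmi hmj, hs]; exact hv1
            · rw [lay_shift_of_ne _ hmi hmj, lay_shift_j hij', hs, hsub]; exact hv2
          · exact ⟨0, by show lay i j s ≠ 0; rw [hs]; exact hne⟩
        · right
          show ((dn s j, ⟨(j, m), hab⟩) : Plaquette d L) = ring hjk (hjk.trans hkl) (dn x j) a
          unfold ring
          rw [eStart_dn]
      · have hai' : a' ≠ i := hai
        have haj' : a' ≠ j := haj
        exfalso
        refine not_mem_restPlaqs_of_layers (fun e => ?_) ?_ hq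
        · have hy' : lay i j y = ((c - 1 : ℕ) : ZMod L) := by
            rcases hy with rfl | rfl
            · exact hs
            · rw [lay_dn_of_ne _ hai' haj', hs]
          fin_cases e <;> simp only [vert] <;>
            [rw [hy']; rw [lay_shift_of_ne _ hai' haj', hy'];
              rw [lay_shift_of_ne _ hmi hmj, hy'];
              rw [lay_shift_of_ne _ hmi hmj, lay_shift_of_ne _ hai' haj', hy']] <;> exact hv1
        · refine ⟨0, ?_⟩
          show lay i j y ≠ 0
          rcases hy with rfl | rfl
          · rw [hs]; exact hne
          · rw [lay_dn_of_ne _ hai' haj', hs]; exact hne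

/-- **The rest plaquettes through an edge of a transverse square on the layer `-(c-1)`** (the
mirror image of the top inner layer): only the ring faces `ring i (z - e_i) a` and `ring j z a`. -/
theorem cover_high {z : Site d L} (hz : lay i j z = -((c - 1 : ℕ) : ZMod L)) {a : Fin 4}
    {q : Plaquette d L} (hq : q ∈ restPlaqs i j c) (hqa : HasLink q (link (sq k l hkl z) a)) :
    q = ring (hij.trans hjk) (hij.trans (hjk.trans hkl)) (dn z i) a ∨
      q = ring hjk (hjk.trans hkl) z a := by
  have hij' : i ≠ j := ne_of_lt hij
  have hki : k ≠ i := (ne_of_lt (hij.trans hjk)).symm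
  have hkj : k ≠ j := (ne_of_lt hjk).symm
  have hli : l ≠ i := (ne_of_lt (hij.trans (hjk.trans hkl))).symm
  have hlj : l ≠ j := (ne_of_lt (hjk.trans hkl)).symm
  have hs : lay i j (eStart k l z a) = -((c - 1 : ℕ) : ZMod L) := by
    rw [lay_eStart hki hkj hli hlj, hz]
  have hmi : eDir k l a ≠ i := by rcases eDir_eq_or (k := k) (l := l) a with h | h <;> rw [h] <;> assumption
  have hmj : eDir k l a ≠ j := by rcases eDir_eq_or (k := k) (l := l) a with h | h <;> rw [h] <;> assumption
  have hjm : j < eDir k l a := by rcases eDir_eq_or (k := k) (l := l) a with h | h <;> rw [h]; exact hjk; exact hjk.trans hkl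
  have hv1 : (-(-((c - 1 : ℕ) : ZMod L))).val < c := by rw [neg_neg]; exact val_cast_lt hL (by omega)
  have hv2 : (-(-((c - 2 : ℕ) : ZMod L))).val < c := by rw [neg_neg]; exact val_cast_lt hL (by omega)
  have hne : -((c - 1 : ℕ) : ZMod L) ≠ 0 := neg_ne_zero.2 (cast_pred_ne_zero hc hL)
  have hsub : -((c - 1 : ℕ) : ZMod L) + 1 = -((c - 2 : ℕ) : ZMod L) := by
    rw [← cast_pred_pred_add_one (L := L) hc]; ring
  set s := eStart k l z a with hsdef
  set m := eDir k l a with hmdef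
  rw [link_sq] at hqa
  obtain ⟨y, ⟨⟨a', b'⟩, hab⟩⟩ := q
  rcases (hasLink_iff' _ s m).1 hqa with ⟨hma, hy⟩ | ⟨hmb, hy⟩
  · simp only at hma hy
    subst hma
    have hbi : b' ≠ i := fun h => by rw [h] at hab; exact lt_asymm hab ((hij.trans hjm))
    have hbj : b' ≠ j := fun h => by rw [h] at hab; exact lt_asymm hab hjm
    exfalso
    have hy' : lay i j y = -((c - 1 : ℕ) : ZMod L) := by
      rcases hy with rfl | rfl
      · exact hs
      · rw [lay_dn_of_ne _ hbi hbj, hs]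
    refine not_mem_restPlaqs_of_neg_layers (fun e => ?_) ⟨0, by show lay i j y ≠ 0; rw [hy']; exact hne⟩ hq
    fin_cases e <;> simp only [vert] <;>
      [rw [hy']; rw [lay_shift_of_ne _ hmi hmj, hy'];
        rw [lay_shift_of_ne _ hbi hbj, hy'];
        rw [lay_shift_of_ne _ hbi hbj, lay_shift_of_ne _ hmi hmj, hy']] <;> exact hv1
  · simp only at hmb hy
    subst hmb
    by_cases hai : a' = i
    · subst a'
      rcases hy with rfl | rfl
      · exfalso
        refine not_mem_restPlaqs_of_neg_layers (fun e => ?_) ⟨0, by show lay i j s ≠ 0; rw [hs]; exact hne⟩ hq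
        fin_cases e <;> simp only [vert]
        · rw [hs]; exact hv1
        · rw [lay_shift_i hij', hs, hsub]; exact hv2
        · rw [lay_shift_of_ne _ hmi hmj, hs]; exact hv1
        · rw [lay_shift_of_ne _ hmi hmj, lay_shift_i hij', hs, hsub]; exact hv2
      · left
        show ((dn s i, ⟨(i, m), hab⟩) : Plaquette d L) = ring (hij.trans hjk) (hij.trans (hjk.trans hkl)) (dn z i) a
        unfold ring
        rw [eStart_dn]
    · by_cases haj : a' = j
      · subst a'
        rcases hy with rfl | rfl
        · exact Or.inr rfl
        · exfalso
          refine not_mem_restPlaqs_of_neg_layers (fun e => ?_)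
            ⟨1, by show lay i j ((dn s j).shift j) ≠ 0; rw [dn_shift, hs]; exact hne⟩ hq
          fin_cases e <;> simp only [vert]
          · rw [lay_dn_j hij', hs, hsub]; exact hv2
          · rw [dn_shift, hs]; exact hv1
          · rw [lay_shift_of_ne _ hmi hmj, lay_dn_j hij', hs, hsub]; exact hv2
          · rw [dn_shift, lay_shift_of_ne _ hmi hmj, hs]; exact hv1
      · have hai' : a' ≠ i := hai
        have haj' : a' ≠ j := haj
        exfalso
        have hy' : lay i j y = -((c - 1 : ℕ) : ZMod L) := by
          rcases hy with rfl | rfl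
          · exact hs
          · rw [lay_dn_of_ne _ hai' haj', hs]
        refine not_mem_restPlaqs_of_neg_layers (fun e => ?_) ⟨0, by show lay i j y ≠ 0; rw [hy']; exact hne⟩ hq
        fin_cases e <;> simp only [vert] <;>
          [rw [hy']; rw [lay_shift_of_ne _ hai' haj', hy'];
            rw [lay_shift_of_ne _ hmi hmj, hy'];
            rw [lay_shift_of_ne _ hmi hmj, lay_shift_of_ne _ hai' haj', hy']] <;> exact hv1

omit hij hjk hkl [NeZero L] in
/-- `-(c-1) - 1 = c` in `ℤ/(2c)`. -/
theorem neg_cast_pred_sub_one : -((c - 1 : ℕ) : ZMod L) - 1 = ((c : ℕ) : ZMod L) := by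
  rw [← neg_cast_c hL, ← cast_pred_add_one (L := L) hc]; ring

/-- The `+e_i` ring faces over a square on the top inner layer lie in the rest. -/
theorem ring_low_i_mem {x : Site d L} (hx : lay i j x = ((c - 1 : ℕ) : ZMod L)) (a : Fin 4) :
    ring (hij.trans hjk) (hij.trans (hjk.trans hkl)) x a ∈ restPlaqs i j c := by
  have hij' : i ≠ j := ne_of_lt hij
  refine mem_restPlaqs_of_back hc hL 1 ?_
  show lay i j ((eStart k l x a).shift i) = _
  rw [lay_shift_i hij', lay_eStart (ne_of_lt (hij.trans hjk)).symm (ne_of_lt hjk).symm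
    (ne_of_lt (hij.trans (hjk.trans hkl))).symm (ne_of_lt (hjk.trans hkl)).symm, hx,
    cast_pred_add_one (L := L) hc]

/-- The `-e_j` ring faces below a square on the top inner layer lie in the rest. -/
theorem ring_low_j_mem {x : Site d L} (hx : lay i j x = ((c - 1 : ℕ) : ZMod L)) (a : Fin 4) :
    ring hjk (hjk.trans hkl) (dn x j) a ∈ restPlaqs i j c := by
  have hij' : i ≠ j := ne_of_lt hij
  refine mem_restPlaqs_of_back hc hL 0 ?_
  show lay i j (eStart k l (dn x j) a) = _
  rw [eStart_dn, lay_dn_j hij', lay_eStart (ne_of_lt (hij.trans hjk)).symm (ne_of_lt hjk).symm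
    (ne_of_lt (hij.trans (hjk.trans hkl))).symm (ne_of_lt (hjk.trans hkl)).symm, hx,
    cast_pred_add_one (L := L) hc]

/-- The `-e_i` ring faces below a square on the layer `-(c-1)` lie in the rest. -/
theorem ring_high_i_mem {z : Site d L} (hz : lay i j z = -((c - 1 : ℕ) : ZMod L)) (a : Fin 4) :
    ring (hij.trans hjk) (hij.trans (hjk.trans hkl)) (dn z i) a ∈ restPlaqs i j c := by
  have hij' : i ≠ j := ne_of_lt hij
  refine mem_restPlaqs_of_back hc hL 0 ?_
  show lay i j (eStart k l (dn z i) a) = _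
  rw [eStart_dn, lay_dn_i hij', lay_eStart (ne_of_lt (hij.trans hjk)).symm (ne_of_lt hjk).symm
    (ne_of_lt (hij.trans (hjk.trans hkl))).symm (ne_of_lt (hjk.trans hkl)).symm, hz,
    neg_cast_pred_sub_one hc hL]

/-- The `+e_j` ring faces over a square on the layer `-(c-1)` lie in the rest. -/
theorem ring_high_j_mem {z : Site d L} (hz : lay i j z = -((c - 1 : ℕ) : ZMod L)) (a : Fin 4) :
    ring hjk (hjk.trans hkl) z a ∈ restPlaqs i j c := by
  have hij' : i ≠ j := ne_of_lt hij
  refine mem_restPlaqs_of_back hc hL 1 ?_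
  show lay i j ((eStart k l z a).shift j) = _
  rw [lay_shift_j hij', lay_eStart (ne_of_lt (hij.trans hjk)).symm (ne_of_lt hjk).symm
    (ne_of_lt (hij.trans (hjk.trans hkl))).symm (ne_of_lt (hjk.trans hkl)).symm, hz,
    neg_cast_pred_sub_one hc hL]

end Cover

end DiagRPTube

end Summit.QuantumFields.GaugeBoot
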